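import Literature.MathematicalPhysics.QuantumLattice.HubbardWave0LiebProofs
import Literature.MathematicalPhysics.QuantumLattice.PairCorrelationsProofs
import Summits.HubbardSuperconductivity.HubbardSuperconductivity.Theorems.EnslavedA1gTorusNormalForms
import Mathlib.Analysis.SpecialFunctions.ContinuousFunctionalCalculus.Abs
import Mathlib.Analysis.CStarAlgebra.Matrix
import Mathlib.Analysis.Matrix.Order
import HarnessLib

/-!
# Route `LiebTwin`, crux `TwinOnsiteCondensation` (stmt-HubbardSuperconductivity-15258), line `birth`:
# the twin pair-order identity (helper, `--supports`)

K2 asks for an `L⁴` floor under `F_s(φ̃) = Re⟨φ̃, Δ_sᴴ Δ_s φ̃⟩` (`Δ_s = pairField sWave L = √2 Σ_x c_{x↑}c_{x↓}`)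
of the TWIN `φ̃ = liebVec n |W|`, `W = liebW n φ`, `|W| = CFC.abs W`. Proved here (finite-dimensional, exact):
`expect_pairField_sWave_eq` — for any `(n,n)`-sector `ψ`, `⟨ψ, Δ_sᴴΔ_s ψ⟩ = 2 Σ_{x,y} Tr(Wᴴ B_{yx} W B_{yx}ᵀ)`,
`B_{yx} = configHop n y x = c†_y c_x` on `n`-subsets (Lieb's transfer); `sum_sum_configHop_mul_configHop` — the
sum rule `Σ_{x,y} B_{yx}B_{xy} = n(|Λ|-n+1)·1` (Yang); `two_mul_trace_mul_mul_mul_conjTranspose` — for Hermitian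
`V`, `2Tr(VBVBᴴ) = Tr(V²(BBᴴ+BᴴB)) - ‖[V,B]‖²_F`; hence `expect_pairField_sWave_liebVec_eq` /
`expect_pairField_sWave_twin_eq`: `F_s(φ̃) = 2n(L²-n+1)‖φ‖² - Σ_{x,y}‖[|W|, c†_y c_x]‖²_F`, with the cap
`re_expect_pairField_sWave_twin_le` and the reading `le_re_expect_pairField_sWave_twin_iff`: K2 is a bound on
the commutation defect of the rectified Lieb matrix against the one-body hopping algebra (a determinant's twin,
`|W|` of rank one, saturates the defect, `F_s = O(L²)`; `|W| ∝ 1` has zero defect and Yang's maximum).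

Sources: E. H. Lieb, PRL **62** (1989) 1201, proof of Thm 1, eqs. (3)–(4); C. N. Yang, Rev. Mod. Phys. **34**
(1962) 694 §4 and PRL **63** (1989) 2144; E. P. Wigner, M. M. Yanase, PNAS **49** (1963) 910 (skew information).
Everything else is bookkeeping; no definition and no named fact is introduced.
-/

-- the mandated namespace `Summit.<Summit>.<Problem>.Theorems` repeats `HubbardSuperconductivity`
-- (single-problem summit, D-0017), which the `dupNamespace` linter flags on every declaration
set_option linter.dupNamespace false

noncomputable section

namespace Summit.HubbardSuperconductivity.HubbardSuperconductivity.Theorems.LiebTwinTwin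

open Matrix Finset Literature.MathematicalPhysics.QuantumLattice
open scoped ComplexOrder

/-! ### Matrix algebra: the commutator form of `Tr(V B V Bᴴ)` -/

section MatrixAlgebra

variable {m : Type*} [Fintype m]

/-- For a Hermitian `V` and any `B`: `2 Tr(V B V Bᴴ) = Tr(V V (B Bᴴ + Bᴴ B)) - Tr([V,B]ᴴ [V,B])`,
`[V, B] = V B - B V` (expand the commutator and use cyclicity of the trace).
Wigner–Yanase, PNAS 49 (1963) 910 (skew information). [folklore] -/
theorem two_mul_trace_mul_mul_mul_conjTranspose {V : Matrix m m ℂ} (hV : Vᴴ = V) (B : Matrix m m ℂ) :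
    2 * (V * B * V * Bᴴ).trace =
      (V * V * (B * Bᴴ + Bᴴ * B)).trace - ((V * B - B * V)ᴴ * (V * B - B * V)).trace := by
  have h1 : (Bᴴ * V * (V * B)).trace = (V * V * (B * Bᴴ)).trace := by
    rw [show Bᴴ * V * (V * B) = Bᴴ * (V * V * B) by simp only [Matrix.mul_assoc],
      Matrix.trace_mul_comm, Matrix.mul_assoc]
  have h2 : (V * Bᴴ * (B * V)).trace = (V * V * (Bᴴ * B)).trace := by
    rw [show V * Bᴴ * (B * V) = (V * (Bᴴ * B)) * V by simp only [Matrix.mul_assoc],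
      Matrix.trace_mul_comm, ← Matrix.mul_assoc]
  have h3 : (Bᴴ * V * (B * V)).trace = (V * B * V * Bᴴ).trace := by
    rw [show Bᴴ * V * (B * V) = Bᴴ * (V * B * V) by simp only [Matrix.mul_assoc],
      Matrix.trace_mul_comm]
  have h4 : (V * Bᴴ * (V * B)).trace = (V * B * V * Bᴴ).trace := by
    rw [show V * Bᴴ * (V * B) = (V * Bᴴ) * (V * B) by rfl, Matrix.trace_mul_comm,
      show V * B * (V * Bᴴ) = V * B * V * Bᴴ by simp only [Matrix.mul_assoc]]
  rw [conjTranspose_sub, conjTranspose_mul, conjTranspose_mul, hV, Matrix.sub_mul, Matrix.mul_sub,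
    Matrix.mul_sub, trace_sub, trace_sub, trace_sub, h1, h2, h3, h4, Matrix.mul_add, trace_add]
  ring

/-- The Frobenius form `Tr(Xᴴ X) = Σ |X_{ab}|²` is real and nonnegative. [folklore] -/
theorem trace_conjTranspose_mul_self_eq (X : Matrix m m ℂ) :
    (Xᴴ * X).trace = ((∑ a, ∑ b, ‖X a b‖ ^ 2 : ℝ) : ℂ) := by
  rw [Matrix.trace]
  simp only [Matrix.diag_apply, Matrix.mul_apply, conjTranspose_apply]
  rw [Finset.sum_comm]
  push_cast
  refine Finset.sum_congr rfl fun a _ => Finset.sum_congr rfl fun b _ => ?_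
  rw [Complex.star_def, Complex.conj_mul']

/-- `Re Tr(Xᴴ X) = Σ |X_{ab}|² ≥ 0`. [folklore] -/
theorem trace_conjTranspose_mul_self_re_nonneg (X : Matrix m m ℂ) : 0 ≤ ((Xᴴ * X).trace).re := by
  rw [trace_conjTranspose_mul_self_eq, Complex.ofReal_re]
  exact Finset.sum_nonneg fun _ _ => Finset.sum_nonneg fun _ _ => by positivity

end MatrixAlgebra

/-! ### Spinless hopping on `n`-subsets: adjoints and the one-body sum rule -/

section Spinless

variable {Λ : Type*} [LinearOrder Λ] [Fintype Λ]

/-- `(c†_y c_x)ᴴ = c†_x c_y` on `n`-subsets: `(configHop n y x)ᴴ = configHop n x y`.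
Lieb, PRL 62 (1989) 1201, proof of Theorem 1 ("`K` is real and symmetric"). [folklore] -/
theorem configHop_conjTranspose (n : ℕ) (y x : Λ) :
    (configHop n y x : Matrix (Config Λ n) (Config Λ n) ℂ)ᴴ = configHop n x y := by
  ext α β
  have h : (creation y * annihilation x : Matrix (Finset Λ) (Finset Λ) ℂ)ᴴ =
      creation x * annihilation y := by
    rw [conjTranspose_mul, creation, creation, conjTranspose_conjTranspose]
  have h' := congrFun (congrFun h α.1) β.1
  rw [conjTranspose_apply] at h'
  rw [conjTranspose_apply]
  exact h'

/-- `(c†_y c_x)ᵀ = c†_x c_y` on `n`-subsets (the entries are real). Lieb, PRL 62 (1989) 1201, proof of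
Theorem 1. [folklore] -/
theorem configHop_transpose (n : ℕ) (y x : Λ) :
    (configHop n y x : Matrix (Config Λ n) (Config Λ n) ℂ)ᵀ = configHop n x y := by
  rw [← configHop_conjTranspose n y x]
  ext α β
  rw [transpose_apply, conjTranspose_apply]
  exact (LiebThm1.star_creation_mul_annihilation_apply y x β.1 α.1).symm

/-- Entries of `c†_y c_x c†_x c_y` on `n`-subsets: diagonal, `[y ∈ α][x ∉ α ∖ y]` (hop to an empty site and
back; the Jordan–Wigner signs square to one). Yang, PRL 63 (1989) 2144. [folklore] -/
theorem configHop_mul_configHop_apply (n : ℕ) (y x : Λ) (α α' : Config Λ n) :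
    (configHop n y x * configHop n x y) α α' =
      if y ∈ α.1 ∧ x ∉ α.1.erase y ∧ α' = α then 1 else 0 := by
  rw [Matrix.mul_apply]
  simp only [configHop, LiebThm1.creation_mul_annihilation_apply]
  by_cases hc : y ∈ α.1 ∧ x ∉ α.1.erase y
  · obtain ⟨hy, hx⟩ := hc
    set γ := α.1.erase y with hγ
    have hcard : (insert x γ).card = n := by
      rw [card_insert_of_notMem hx, hγ, card_erase_of_mem hy]
      have h1 := α.2
      have h2 := card_pos.2 ⟨y, hy⟩
      omega
    rw [Finset.sum_eq_single ⟨insert x γ, hcard⟩]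
    · have hyγ : y ∉ γ := notMem_erase y α.1
      have hins : insert y γ = α.1 := by rw [hγ, insert_erase hy]
      have e1 : (⟨insert x γ, hcard⟩ : Config Λ n).1 = insert x γ := rfl
      rw [e1, if_pos ⟨hy, hx, rfl⟩, erase_insert hx, hins]
      by_cases hα : α' = α
      · subst hα
        rw [if_pos ⟨mem_insert_self x γ, hyγ, rfl⟩, if_pos ⟨hy, hx, rfl⟩]
        linear_combination (jwSign x γ * jwSign x γ) * jwSign_mul_self y γ + jwSign_mul_self x γ
      · rw [if_neg (fun h => hα (Subtype.ext h.2.2)), mul_zero, if_neg (fun h => hα h.2.2)]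
    · intro β _ hβ
      rw [if_neg, zero_mul]
      rintro ⟨-, -, h⟩
      exact hβ (Subtype.ext h)
    · exact fun h => absurd (mem_univ _) h
  · rw [if_neg (fun h => hc ⟨h.1, h.2.1⟩)]
    refine Finset.sum_eq_zero fun β _ => ?_
    rw [if_neg (fun h => hc ⟨h.1, h.2.1⟩), zero_mul]

/-- **One-body sum rule** `Σ_x Σ_y configHop n y x * configHop n x y = n(|Λ| - n + 1) · 1` on `n`-subsets
(the identity behind Yang's bound `⟨η†η⟩ ≤ n(M - n + 1)`). Yang, PRL 63 (1989) 2144. [folklore] -/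
theorem sum_sum_configHop_mul_configHop (n : ℕ) :
    ∑ x : Λ, ∑ y : Λ, configHop n y x * configHop n x y =
      ((n : ℂ) * ((Fintype.card Λ : ℂ) - n + 1)) • (1 : Matrix (Config Λ n) (Config Λ n) ℂ) := by
  ext α α'
  simp only [Matrix.sum_apply, configHop_mul_configHop_apply, Matrix.smul_apply, Matrix.one_apply,
    smul_eq_mul]
  by_cases hα : α = α'
  · subst hα
    simp only [and_true, if_true, mul_one]
    rw [Finset.sum_comm]
    -- `Σ_y [y ∈ α] Σ_x [x ∉ α ∖ y] = Σ_{y ∈ α} (|Λ| - (n - 1))`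
    have hx : ∀ y : Λ, y ∈ α.1 →
        (∑ x : Λ, (if y ∈ α.1 ∧ x ∉ α.1.erase y then (1 : ℂ) else 0)) =
          (Fintype.card Λ : ℂ) - n + 1 := by
      intro y hy
      simp only [hy, true_and]
      rw [Finset.sum_boole]
      have hfilter : (univ.filter fun x : Λ => x ∉ α.1.erase y) = (α.1.erase y)ᶜ := by
        ext x; simp only [Finset.mem_filter, Finset.mem_univ, true_and, Finset.mem_compl]
      rw [hfilter, Finset.card_compl, card_erase_of_mem hy, α.2]
      have h1 : 1 ≤ n := by
        have := card_pos.2 ⟨y, hy⟩; rw [α.2] at this; exact this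
      have h2 : n ≤ Fintype.card Λ := by
        have := Finset.card_le_univ α.1; rw [α.2] at this; exact this
      rw [Nat.cast_sub (by omega), Nat.cast_sub h1]
      push_cast
      ring
    rw [Finset.sum_congr rfl fun y _ => show (∑ x : Λ, (if y ∈ α.1 ∧ x ∉ α.1.erase y then (1 : ℂ) else 0)) =
        if y ∈ α.1 then (Fintype.card Λ : ℂ) - n + 1 else 0 by
      by_cases hy : y ∈ α.1
      · rw [if_pos hy, hx y hy]
      · rw [if_neg hy]; exact Finset.sum_eq_zero fun x _ => if_neg fun h => hy h.1]
    rw [← Finset.sum_filter, Finset.sum_const]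
    have : (univ.filter fun y : Λ => y ∈ α.1) = α.1 := by ext y; simp
    rw [this, α.2, nsmul_eq_mul]
  · rw [if_neg hα, mul_zero]
    refine Finset.sum_eq_zero fun x _ => Finset.sum_eq_zero fun y _ => ?_
    rw [if_neg]
    rintro ⟨-, -, h⟩
    exact hα h.symm

/-- The symmetrised one-body sum rule: `Σ_x Σ_y (B_{yx} B_{xy} + B_{xy} B_{yx}) = 2n(|Λ| - n + 1) · 1` on
`n`-subsets (the second double sum is the first with `x`, `y` renamed). Yang, PRL 63 (1989) 2144. [folklore] -/
theorem sum_sum_configHop_symm (n : ℕ) :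
    ∑ x : Λ, ∑ y : Λ, (configHop n y x * configHop n x y + configHop n x y * configHop n y x) =
      (2 * ((n : ℂ) * ((Fintype.card Λ : ℂ) - n + 1))) • (1 : Matrix (Config Λ n) (Config Λ n) ℂ) := by
  simp_rw [Finset.sum_add_distrib]
  have h2 : ∑ x : Λ, ∑ y : Λ, configHop n x y * configHop n y x =
      ∑ x : Λ, ∑ y : Λ, configHop n y x * configHop n x y := Finset.sum_comm
  rw [h2, sum_sum_configHop_mul_configHop, ← two_smul ℂ, smul_smul]

/-- Trace form of the symmetrised sum rule: for every matrix `A` on `n`-subsets,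
`Σ_x Σ_y Tr(A (B_{yx} B_{xy} + B_{xy} B_{yx})) = 2n(|Λ| - n + 1) Tr A`. Yang, PRL 63 (1989) 2144. [folklore] -/
theorem sum_sum_trace_mul_configHop_symm (n : ℕ) (A : Matrix (Config Λ n) (Config Λ n) ℂ) :
    ∑ x : Λ, ∑ y : Λ, (A * (configHop n y x * configHop n x y + configHop n x y * configHop n y x)).trace =
      2 * ((n : ℂ) * ((Fintype.card Λ : ℂ) - n + 1)) * A.trace := by
  have hfac : ∑ x : Λ, ∑ y : Λ,
      (A * (configHop n y x * configHop n x y + configHop n x y * configHop n y x)).trace =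
        (A * ∑ x : Λ, ∑ y : Λ, (configHop n y x * configHop n x y + configHop n x y * configHop n y x)).trace := by
    simp_rw [Matrix.mul_sum, Matrix.trace_sum]
  rw [hfac, sum_sum_configHop_symm, Matrix.mul_smul, Matrix.mul_one, trace_smul, smul_eq_mul]

end Spinless

/-! ### The on-site pair operator in Lieb coordinates -/

section PairTransfer

variable {Λ : Type*} [LinearOrder Λ] [Fintype Λ]

/-- CAR reordering of one term of `ηᴴ η`, `η = Σ_x c_{x↑} c_{x↓}`:
`(c_{y↑} c_{y↓})ᴴ (c_{x↑} c_{x↓}) = (c†_{y↑} c_{x↑}) (c†_{y↓} c_{x↓})` (two anticommutations of operators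
on distinct orbitals). Yang, PRL 63 (1989) 2144. [folklore] -/
theorem pair_conjTranspose_mul_pair (x y : Λ) :
    (annihilation (orb y 0) * annihilation (orb y 1) : Matrix (Finset (Orb Λ)) (Finset (Orb Λ)) ℂ)ᴴ *
        (annihilation (orb x 0) * annihilation (orb x 1)) =
      creation (orb y 0) * annihilation (orb x 0) * (creation (orb y 1) * annihilation (orb x 1)) := by
  rw [conjTranspose_mul]
  change creation (orb y 1) * creation (orb y 0) * (annihilation (orb x 0) * annihilation (orb x 1)) = _
  have h01 : (orb x 0 : Orb Λ) ≠ orb y 1 := by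
    rw [Ne, orb_inj]
    exact fun h => absurd h.2 (by decide)
  have hac : creation (orb y 1) * annihilation (orb x 0) =
      -(annihilation (orb x 0) * creation (orb y 1) : Matrix (Finset (Orb Λ)) (Finset (Orb Λ)) ℂ) := by
    rw [annihilation_mul_creation, if_neg h01, zero_sub, neg_neg]
  calc creation (orb y 1) * creation (orb y 0) * (annihilation (orb x 0) * annihilation (orb x 1))
      = -(creation (orb y 0) * (creation (orb y 1) * annihilation (orb x 0)) * annihilation (orb x 1)) := by
        rw [creation_mul_creation_eq_neg (orb y 1) (orb y 0)]
        simp only [neg_mul, Matrix.mul_assoc]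
    _ = creation (orb y 0) * annihilation (orb x 0) * (creation (orb y 1) * annihilation (orb x 1)) := by
        rw [hac]
        simp only [mul_neg, neg_mul, neg_neg, Matrix.mul_assoc]

/-- **The on-site pair order in Lieb coordinates.** For `ψ` in the `(n, n)` sector and `η = Σ_x c_{x↑} c_{x↓}`:
`⟨ηψ, ηψ⟩ = Σ_x Σ_y Tr(W(ψ)ᴴ B_{yx} W(ψ) B_{yx}ᵀ)`, `B_{yx} = configHop n y x` (up hopping acts on `W` from
the left, down hopping from the right by the transpose; `ψ ↦ W` is unitary). Lieb, PRL 62 (1989) 1201,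
eqs. (3)–(4); Yang, PRL 63 (1989) 2144. [folklore] -/
theorem star_pairVec_dotProduct_eq {n : ℕ} {ψ : Fock (Orb Λ)} (hψ : IsInSector n n ψ) :
    star ((∑ x : Λ, annihilation (orb x 0) * annihilation (orb x 1)) *ᵥ ψ) ⬝ᵥ
        ((∑ x : Λ, annihilation (orb x 0) * annihilation (orb x 1)) *ᵥ ψ) =
      ∑ x : Λ, ∑ y : Λ,
        ((liebW n ψ)ᴴ * (configHop n y x * (liebW n ψ * (configHop n y x)ᵀ))).trace := by
  rw [← LiebThm1.star_dotProduct_conjTranspose_mul_mulVec]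
  have hprod : (∑ x : Λ, annihilation (orb x 0) * annihilation (orb x 1) :
        Matrix (Finset (Orb Λ)) (Finset (Orb Λ)) ℂ)ᴴ *
        (∑ x : Λ, annihilation (orb x 0) * annihilation (orb x 1)) =
      ∑ x : Λ, ∑ y : Λ,
        creation (orb y 0) * annihilation (orb x 0) * (creation (orb y 1) * annihilation (orb x 1)) := by
    rw [conjTranspose_sum, Finset.sum_mul]
    simp_rw [Finset.mul_sum]
    rw [Finset.sum_comm]
    exact Finset.sum_congr rfl fun x _ => Finset.sum_congr rfl fun y _ => pair_conjTranspose_mul_pair x y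
  rw [hprod, Matrix.sum_mulVec, dotProduct_sum]
  refine Finset.sum_congr rfl fun x _ => ?_
  rw [Matrix.sum_mulVec, dotProduct_sum]
  refine Finset.sum_congr rfl fun y _ => ?_
  rw [← LiebThm1.hsInner_liebW hψ, hsInner, ← mulVec_mulVec, LiebThm1.liebW_hopping_up_mulVec,
    LiebThm1.liebW_hopping_down_mulVec]

end PairTransfer

/-! ### The identity on the torus `(ℤ/Lℤ)²` -/

section Torus

variable {L : ℕ} [NeZero L]

/-- `Δ_s = pairField sWave L = √2 Σ_x c_{x↑} c_{x↓}`, summed over the sites of the fermionic torus.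
Scalapino, Phys. Rep. 250 (1995) 329, §2. [folklore] -/
theorem pairField_sWave_eq_smul_sum :
    pairField sWave L = ((Real.sqrt 2 : ℝ) : ℂ) •
      ∑ x : FermionTorus 2 L, annihilation (orb x 0) * annihilation (orb x 1) := by
  rw [Summit.HubbardSuperconductivity.EnslavedA1g.pairField_sWave, ← Finset.smul_sum]
  congr 1
  exact Fintype.sum_equiv (FermionTorus.equivTorusSite (d := 2) (L := L)).symm _ _ fun x => rfl

omit [NeZero L] in
/-- `|Λ| = L²` for the fermionic torus of side `L`. Friedli–Velenik (2017) §3.1. [folklore] -/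
theorem card_fermionTorus_two_cast : ((Fintype.card (FermionTorus 2 L) : ℕ) : ℂ) = (L : ℂ) ^ 2 := by
  have : Fintype.card (FermionTorus 2 L) = L ^ 2 := by
    simp [FermionTorus, Fintype.card_lex, Fintype.card_fin]
  rw [this]
  push_cast
  ring

/-- **The on-site pair order in Lieb coordinates (torus).** For every `(n, n)`-sector vector `ψ` on the
torus of side `L`: `⟨ψ, Δ_sᴴ Δ_s ψ⟩ = 2 Σ_x Σ_y Tr(W(ψ)ᴴ B_{yx} W(ψ) B_{yx}ᵀ)`, `B_{yx} = configHop n y x`.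
Lieb, PRL 62 (1989) 1201, eqs. (3)–(4); Yang, PRL 63 (1989) 2144. [folklore] -/
theorem expect_pairField_sWave_eq {n : ℕ} {ψ : Fock (Orb (FermionTorus 2 L))} (hψ : IsInSector n n ψ) :
    expect ((pairField sWave L)ᴴ * pairField sWave L) ψ =
      2 * ∑ x : FermionTorus 2 L, ∑ y : FermionTorus 2 L,
        ((liebW n ψ)ᴴ * (configHop n y x * (liebW n ψ * (configHop n y x)ᵀ))).trace := by
  rw [Literature.MathematicalPhysics.QuantumLattice.expect, LiebThm1.star_dotProduct_conjTranspose_mul_mulVec,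
    pairField_sWave_eq_smul_sum,
    Matrix.smul_mulVec, star_smul, smul_dotProduct, dotProduct_smul, smul_smul,
    star_pairVec_dotProduct_eq hψ, smul_eq_mul]
  congr 1
  rw [Complex.star_def, Complex.conj_ofReal, ← Complex.ofReal_mul,
    Real.mul_self_sqrt (by norm_num : (0 : ℝ) ≤ 2)]
  norm_num

/-- **Twin pair-order identity (Hermitian Lieb matrices).** For Hermitian `V` on `n`-subsets of the torus,
`⟨liebVec n V, Δ_sᴴ Δ_s liebVec n V⟩ = 2n(L² - n + 1)·Tr(VᴴV) - Σ_x Σ_y Tr([V, B_{yx}]ᴴ [V, B_{yx}])`,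
`B_{yx} = configHop n y x`. Lieb, PRL 62 (1989) 1201; Yang, PRL 63 (1989) 2144; Wigner–Yanase (1963). [folklore] -/
theorem expect_pairField_sWave_liebVec_eq (n : ℕ)
    {V : Matrix (Config (FermionTorus 2 L) n) (Config (FermionTorus 2 L) n) ℂ} (hV : Vᴴ = V) :
    expect ((pairField sWave L)ᴴ * pairField sWave L) (liebVec n V) =
      2 * ((n : ℂ) * ((L : ℂ) ^ 2 - n + 1)) * (Vᴴ * V).trace -
        ∑ x : FermionTorus 2 L, ∑ y : FermionTorus 2 L,
          ((V * configHop n y x - configHop n y x * V)ᴴ * (V * configHop n y x - configHop n y x * V)).trace := by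
  rw [expect_pairField_sWave_eq (isInSector_liebVec n V), LiebThm1.liebW_liebVec]
  have hterm : ∀ x y : FermionTorus 2 L,
      (Vᴴ * (configHop n y x * (V * (configHop n y x)ᵀ))).trace =
        (V * configHop n y x * V * (configHop n y x)ᴴ).trace := by
    intro x y
    rw [hV, configHop_transpose, configHop_conjTranspose]
    simp only [Matrix.mul_assoc]
  simp_rw [hterm]
  rw [Finset.mul_sum]
  simp_rw [Finset.mul_sum, two_mul_trace_mul_mul_mul_conjTranspose hV, Finset.sum_sub_distrib]
  congr 1
  simp_rw [configHop_conjTranspose]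
  rw [sum_sum_trace_mul_configHop_symm, card_fermionTorus_two_cast, hV]

open scoped MatrixOrder Matrix.Norms.L2Operator in
/-- **Twin pair-order identity.** For every `(n, n)`-sector `φ` on the torus, the twin `φ̃ = liebVec n |W|`
(`W = liebW n φ`, `|W| = CFC.abs W`, Hermitian with `|W|² = WᴴW`, `Tr(WᴴW) = ‖φ‖²`) has
`⟨φ̃, Δ_sᴴ Δ_s φ̃⟩ = 2n(L² - n + 1)·‖φ‖² - Σ_x Σ_y Tr([|W|, B_{yx}]ᴴ [|W|, B_{yx}])`.
Lieb, PRL 62 (1989) 1201; Yang, PRL 63 (1989) 2144; Wigner–Yanase, PNAS 49 (1963) 910. [folklore] -/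
theorem expect_pairField_sWave_twin_eq :
    ∀ (L : ℕ) [NeZero L] (n : ℕ) (φ : Fock (Orb (FermionTorus 2 L))), IsInSector n n φ →
      expect ((pairField sWave L)ᴴ * pairField sWave L) (liebVec n (CFC.abs (liebW n φ))) =
        2 * ((n : ℂ) * ((L : ℂ) ^ 2 - n + 1)) * (star φ ⬝ᵥ φ) -
          ∑ x : FermionTorus 2 L, ∑ y : FermionTorus 2 L,
            ((CFC.abs (liebW n φ) * configHop n y x - configHop n y x * CFC.abs (liebW n φ))ᴴ *
              (CFC.abs (liebW n φ) * configHop n y x - configHop n y x * CFC.abs (liebW n φ))).trace := by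
  intro L _ n φ hφ
  have hsa : (CFC.abs (liebW n φ))ᴴ = CFC.abs (liebW n φ) :=
    (CFC.abs_nonneg (liebW n φ)).isSelfAdjoint.star_eq
  rw [expect_pairField_sWave_liebVec_eq n hsa, hsa, CFC.abs_mul_abs, ← LiebThm1.hsInner_liebW hφ φ,
    hsInner, Matrix.star_eq_conjTranspose]

open scoped MatrixOrder Matrix.Norms.L2Operator in
/-- **Twin pair-order identity, real form.** With `F_s(χ) = Re⟨χ, Δ_sᴴ Δ_s χ⟩`:
`F_s(φ̃) = 2n(L² - n + 1)‖φ‖² - Σ_{x,y} Σ_{α,β} |[|W|, c†_y c_x]_{αβ}|²` for every `(n,n)`-sector `φ`.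
Lieb, PRL 62 (1989) 1201; Yang, PRL 63 (1989) 2144; Wigner–Yanase, PNAS 49 (1963) 910. [folklore] -/
theorem re_expect_pairField_sWave_twin_eq {n : ℕ} {φ : Fock (Orb (FermionTorus 2 L))}
    (hφ : IsInSector n n φ) :
    (expect ((pairField sWave L)ᴴ * pairField sWave L) (liebVec n (CFC.abs (liebW n φ)))).re =
      2 * ((n : ℝ) * ((L : ℝ) ^ 2 - n + 1)) * (star φ ⬝ᵥ φ).re -
        ∑ x : FermionTorus 2 L, ∑ y : FermionTorus 2 L,
          ∑ α : Config (FermionTorus 2 L) n, ∑ β : Config (FermionTorus 2 L) n,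
            ‖(CFC.abs (liebW n φ) * configHop n y x - configHop n y x * CFC.abs (liebW n φ)) α β‖ ^ 2 := by
  rw [expect_pairField_sWave_twin_eq L n φ hφ, Complex.sub_re, Complex.re_sum]
  simp_rw [Complex.re_sum, trace_conjTranspose_mul_self_eq, Complex.ofReal_re]
  congr 1
  have : (2 * ((n : ℂ) * ((L : ℂ) ^ 2 - n + 1))) = ((2 * ((n : ℝ) * ((L : ℝ) ^ 2 - n + 1)) : ℝ) : ℂ) := by
    push_cast; ring
  rw [this, Complex.re_ofReal_mul]

open scoped MatrixOrder Matrix.Norms.L2Operator in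
/-- **Yang's cap for twins** (immediate from the identity): `F_s(φ̃) ≤ 2n(L² - n + 1)‖φ‖²`, with equality
iff `|W|` commutes with every `c†_y c_x` (e.g. `|W| ∝ 1`, the `η`-paired twin). Yang, Rev. Mod. Phys. 34
(1962) 694, §4; Yang, PRL 63 (1989) 2144. [folklore] -/
theorem re_expect_pairField_sWave_twin_le {n : ℕ} {φ : Fock (Orb (FermionTorus 2 L))}
    (hφ : IsInSector n n φ) :
    (expect ((pairField sWave L)ᴴ * pairField sWave L) (liebVec n (CFC.abs (liebW n φ)))).re ≤
      2 * ((n : ℝ) * ((L : ℝ) ^ 2 - n + 1)) * (star φ ⬝ᵥ φ).re := by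
  rw [re_expect_pairField_sWave_twin_eq hφ, sub_le_self_iff]
  positivity

open scoped MatrixOrder Matrix.Norms.L2Operator in
/-- **The crux floor as a defect bound.** For a `(n,n)`-sector `φ` and real `c`: `c ≤ F_s(φ̃)` iff the total
commutation defect `Σ_{x,y}‖[|W|, c†_y c_x]‖²_F` is at most `2n(L² - n + 1)‖φ‖² - c` (the form in which K2,
`c = c₀L⁴`, has to be attacked). Lieb, PRL 62 (1989) 1201; Yang, PRL 63 (1989) 2144. [folklore] -/
theorem le_re_expect_pairField_sWave_twin_iff {n : ℕ} {φ : Fock (Orb (FermionTorus 2 L))}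
    (hφ : IsInSector n n φ) (c : ℝ) :
    c ≤ (expect ((pairField sWave L)ᴴ * pairField sWave L) (liebVec n (CFC.abs (liebW n φ)))).re ↔
      ∑ x : FermionTorus 2 L, ∑ y : FermionTorus 2 L,
          ∑ α : Config (FermionTorus 2 L) n, ∑ β : Config (FermionTorus 2 L) n,
            ‖(CFC.abs (liebW n φ) * configHop n y x - configHop n y x * CFC.abs (liebW n φ)) α β‖ ^ 2 ≤
        2 * ((n : ℝ) * ((L : ℝ) ^ 2 - n + 1)) * (star φ ⬝ᵥ φ).re - c := by
  rw [re_expect_pairField_sWave_twin_eq hφ]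
  constructor <;> intro h <;> linarith

end Torus

end Summit.HubbardSuperconductivity.HubbardSuperconductivity.Theorems.LiebTwinTwin

end
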